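import Literature.Analysis.FluidPDE.LocalTypeIReverseZoom
import Literature.Analysis.FluidPDE.LocalTypeILscVelocity
import Literature.Analysis.FluidPDE.LocalTypeILscGradient
import Literature.Analysis.FluidPDE.LocalTypeIProofs
import Literature.Analysis.FluidPDE.LocalTypeIPersistenceHolds
import HarnessLib

/-!
# Albritton–Barker 2019, Thm 1.1, reverse direction — the mildness hypothesis is not used

Trunk T-FLUID (`Literature/Analysis/FluidPDE`), family NS; proofs layer over
`Literature/Analysis/FluidPDE/LocalTypeI.lean`. No new definitions, no named facts.

The accepted theorem `localTypeISingularityExists_of_nontrivialMildAncientTypeIExists`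
(`LocalTypeIReverse.lean`) proves `NontrivialMildAncientTypeIExists → LocalTypeISingularityExists`
(A–B Thm 1.1, reverse direction: blow-down `v^{(k)}(x,t) = k v(kx, k²t)` of a non-trivial mild
bounded ancient solution with `𝐈 < ∞`, compactness Lemma 2.2, persistence Prop. 2.3, lower
semicontinuity of `A, C, D, E`). Its proof discards the conjunct `IsBoundedAncientMildSolution 1 u`
at its first line: the blow-down argument consumes only the suitable-weak data on the slab, the
weak gradient, `𝐈(ℝ³ × ℝ₋) < ∞` and non-triviality. This file records that observation as a
theorem, with the same proof, verbatim:

* `localTypeISingularityExists_of_suitable_nontrivial` — ANY suitable weak solution on the slab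
  `(-∞,0) × ℝ³` with a weak spatial gradient, `𝐈 < ∞` and `u ≢ 0` a.e. yields a suitable weak
  solution with a Type I singular point (conditional on `SuitableCompactness`,
  `PersistenceOfSingularities`, exactly as the accepted theorem);
* `localTypeISingularityExists_of_suitable_nontrivial'` — the same with the two tools discharged
  (`SuitableCompactness_holds`, `PersistenceOfSingularities_holds`).
(The accepted mild statement is the special case where the unused conjunct is supplied.)

Use (crux `RellichScar.ApexLocalisation`, line `decaying-ancient-bridge`): the antecedents of the
line's stubs ("a non-trivial bounded decaying ancient solution with suitable data and `𝐈 < ⊤`", "a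
non-trivial suitable slab solution with `𝐈 < ⊤` and shifted space–time decay") are therefore
inhabited only if a Type I singularity exists (A–B's open first bullet), without any appeal to the
Oseen/mild structure.

## References

* D. Albritton, T. Barker, *On local Type I singularities of the Navier–Stokes equations and
  Liouville theorems*, J. Math. Fluid Mech. 21 (2019), arXiv:1811.00502, Thm 1.1, Lemma 2.2,
  Prop. 2.3, §3 (proof of Thm 1.1, reverse direction). [AlbrittonBarker2019]
-/

noncomputable section

open MeasureTheory Set Function Filter Topology TopologicalSpace Metric
open scoped NNReal ENNReal InnerProductSpace RealInnerProductSpace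

namespace Literature.Analysis.FluidPDE

/-- **Albritton–Barker 2019, Theorem 1.1, reverse direction, for ANY non-trivial suitable weak slab
solution with `𝐈 < ∞`** (mildness is not used): if `(u₀, p₀)` is a suitable weak solution of
unit-viscosity unforced Navier–Stokes on the slab `(-∞, 0) × ℝ³` with weak spatial gradient `G₀`,
`𝐈(ℝ³ × ℝ₋) < ∞`, and `u₀` is not a.e. zero there, then there is a suitable weak solution with a
Type I singular point (`LocalTypeISingularityExists`) — the blow-down limit of
`v^{(k)}(x, t) = k u₀(x₁ + k x, t₁ + k² t)`, singular at the origin by persistence of singularities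
and Type I by lower semicontinuity of `A, C, D, E`. Proof verbatim that of
`localTypeISingularityExists_of_nontrivialMildAncientTypeIExists`.
[cite: AlbrittonBarker2019, Thm 1.1 and §3] -/
theorem localTypeISingularityExists_of_suitable_nontrivial
    (h22 : SuitableCompactness) (h23 : PersistenceOfSingularities)
    {u₀ : ℝ → EuclideanSpace ℝ (Fin 3) → EuclideanSpace ℝ (Fin 3)}
    {p₀ : ℝ → EuclideanSpace ℝ (Fin 3) → ℝ}
    {G₀ : ℝ → EuclideanSpace ℝ (Fin 3) → EuclideanSpace ℝ (Fin 3) →L[ℝ] EuclideanSpace ℝ (Fin 3)}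
    (hsw : IsSuitableWeakSolutionOn (slab (EuclideanSpace ℝ (Fin 3)) (Iio 0) isOpen_Iio) 1 0 u₀ p₀)
    (hwg : HasWeakSpatialGradientOn (slab (EuclideanSpace ℝ (Fin 3)) (Iio 0) isOpen_Iio) u₀ G₀)
    (hnt : ¬ (uncurry u₀ =ᵐ[volume.restrict (Iio (0 : ℝ) ×ˢ (univ : Set (EuclideanSpace ℝ (Fin 3))))] 0))
    (hI : typeIBound (Iio (0 : ℝ) ×ˢ (univ : Set (EuclideanSpace ℝ (Fin 3)))) u₀ p₀ G₀ < ∞) :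
    LocalTypeISingularityExists := by
  set I := typeIBound (Iio (0 : ℝ) ×ˢ (univ : Set (EuclideanSpace ℝ (Fin 3)))) u₀ p₀ G₀ with hIdef
  have hItop : I ≠ ∞ := hI.ne
  -- Step 1: translation
  have hu₀m : AEStronglyMeasurable (uncurry u₀)
      (volume.restrict (Iio (0 : ℝ) ×ˢ (univ : Set (EuclideanSpace ℝ (Fin 3))))) :=
    hwg.locallyIntegrableOn.aestronglyMeasurable
  obtain ⟨z₁, hz₁, hN⟩ := exists_center_eLpNorm_top_ne_zero hu₀m hnt
  -- Step 2: the blow-down sequence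
  set c : ℕ → ℝ := fun k => (k : ℝ) + 1 with hc
  have hcpos : ∀ k, 0 < c k := fun k => by positivity
  have hctop : Tendsto c atTop atTop :=
    tendsto_atTop_add_const_right _ _ tendsto_natCast_atTop_atTop
  set v : ℕ → ℝ → EuclideanSpace ℝ (Fin 3) → EuclideanSpace ℝ (Fin 3) :=
    fun k => c k • stPull (c k ^ 2) (c k) z₁.1 z₁.2 u₀ with hv
  set qf : ℕ → ℝ → EuclideanSpace ℝ (Fin 3) → ℝ :=
    fun k => c k ^ 2 • stPull (c k ^ 2) (c k) z₁.1 z₁.2 p₀ with hqf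
  set G : ℕ → ℝ → EuclideanSpace ℝ (Fin 3) →
      EuclideanSpace ℝ (Fin 3) →L[ℝ] EuclideanSpace ℝ (Fin 3) :=
    fun k => c k ^ 2 • stPull (c k ^ 2) (c k) z₁.1 z₁.2 G₀ with hG
  set q : ℕ → ℝ → EuclideanSpace ℝ (Fin 3) → ℝ :=
    fun k t x => qf k t x - ⨍ y in ball (0 : EuclideanSpace ℝ (Fin 3)) 1, qf k t y with hq
  -- Step 3: the hypotheses of Lemma 2.2
  have hball : ∀ k, IsSuitableWeakSolutionInBall 1 0 (v k) (q k) := fun k =>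
    isSuitableWeakSolutionInBall_zoom hsw hwg hItop (hcpos k) hz₁ z₁.2
  have hsup : (⨆ k, eLpNorm (uncurry (v k)) 3
        (volume.restrict (parabolicCylinder 1 (0 : ℝ × EuclideanSpace ℝ (Fin 3)))) +
      eLpNorm (uncurry (q k)) (3 / 2)
        (volume.restrict (parabolicCylinder 1 (0 : ℝ × EuclideanSpace ℝ (Fin 3))))) < ∞ := by
    refine lt_of_le_of_lt (iSup_le fun k => add_le_add
      (eLpNorm_zoom_velocity_le (hcpos k) hz₁.le z₁.2 p₀ G₀)
      (eLpNorm_zoom_pressure_le (hcpos k) hz₁.le z₁.2 u₀ G₀)) ?_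
    exact ENNReal.add_lt_top.2 ⟨ENNReal.rpow_lt_top_of_nonneg (by norm_num) hItop,
      ENNReal.rpow_lt_top_of_nonneg (by norm_num) hItop⟩
  -- Step 4: Lemma 2.2
  obtain ⟨u, p, σ, hσ, hlim⟩ := h22 v q hball hsup
  -- Step 5: persistence of singularities along the subsequence
  have hsing : IsBackwardSingularPoint u 0 := by
    refine h23 (fun j => v (σ j)) (fun j => q (σ j)) u p (fun j => hball (σ j)) ?_ ?_ ?_
    · refine lt_of_le_of_lt (iSup_le fun j => ?_) hsup
      exact le_iSup (fun k => eLpNorm (uncurry (v k)) 3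
        (volume.restrict (parabolicCylinder 1 (0 : ℝ × EuclideanSpace ℝ (Fin 3)))) +
        eLpNorm (uncurry (q k)) (3 / 2)
        (volume.restrict (parabolicCylinder 1 (0 : ℝ × EuclideanSpace ℝ (Fin 3))))) (σ j)
    · intro R hR
      obtain ⟨h1, -, h3, h4⟩ := hlim R hR
      exact ⟨h1, h3, h4⟩
    · intro R hR
      exact (tendsto_eLpNorm_top_nsZoom_atTop (u := u₀) (fun j => hcpos (σ j))
        (hctop.comp hσ.tendsto_atTop) hN hR.1).limsup_eq
  -- Step 6: the origin is a Type I singular point of `(u, p)` in `Q(0, 1/2)`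
  have h34 : (3 / 4 : ℝ) ∈ Ioo (0 : ℝ) 1 := ⟨by norm_num, by norm_num⟩
  have h12 : (1 / 2 : ℝ) ∈ Ioo (0 : ℝ) 1 := ⟨by norm_num, by norm_num⟩
  obtain ⟨hball34, -, hconv34, hweak34⟩ := hlim (3 / 4) h34
  obtain ⟨-, -, ⟨Gu, hGu, hGu2⟩, hp34⟩ := hball34
  set Q₀ := parabolicCylinder (3 / 4) (0 : ℝ × EuclideanSpace ℝ (Fin 3)) with hQ₀
  have hmono : ∀ {ρ ρ' : ℝ}, 0 ≤ ρ → ρ ≤ ρ' → ∀ w : ℝ × EuclideanSpace ℝ (Fin 3),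
      parabolicCylinder ρ w ⊆ parabolicCylinder ρ' w := by
    intro ρ ρ' hρ hρρ' w
    have h2 : ρ ^ 2 ≤ ρ' ^ 2 := pow_le_pow_left₀ hρ hρρ' 2
    exact prod_mono (Ioo_subset_Ioo (by linarith) le_rfl) (ball_subset_ball hρρ')
  have h1234 : parabolicCylinder (1 / 2) (0 : ℝ × EuclideanSpace ℝ (Fin 3)) ⊆ Q₀ :=
    hmono (by norm_num) (by norm_num) 0
  have hle34 := fun k => parabolicCylinderOpens_le_stPreimage_slab (c k) hz₁ z₁.2 (3 / 4)
  refine ⟨1 / 2, 0, u, p, by norm_num, (hlim (1 / 2) h12).1, hsing, Gu,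
    hGu.mono (fun w hw => h1234 hw), ?_⟩
  have h4I : I + I + I + I < ∞ := by
    simp only [lt_top_iff_ne_top, ne_eq, ENNReal.add_eq_top, hItop, or_self, not_false_eq_true]
  refine lt_of_le_of_lt (typeIBound_le_iff.2 fun r hr z hz => ?_) h4I
  have hzQ : parabolicCylinder r z ⊆ Q₀ := hz.trans h1234
  have hz0 : z.1 ≤ 0 := fst_nonpos_of_parabolicCylinder_subset hr hz
  have hleΩ : parabolicCylinderOpens r z ≤ parabolicCylinderOpens (3 / 4)
      (0 : ℝ × EuclideanSpace ℝ (Fin 3)) := fun w hw => hzQ hw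
  have hbd : ∀ k, abScaledSum r z (v k) (qf k) (G k) ≤ I := fun k =>
    abScaledSum_zoom_le_typeIBound (hcpos k) hz₁.le z₁.2 hr hz0
  -- measurability and weak gradients of the approximants on `Q(0, 3/4)`
  have hwgk : ∀ k, HasWeakSpatialGradientOn (parabolicCylinderOpens (3 / 4)
      (0 : ℝ × EuclideanSpace ℝ (Fin 3))) (v k) (G k) := fun k =>
    (zoom_hasWeakSpatialGradientOn hwg (hcpos k) z₁.1 z₁.2).mono (hle34 k)
  have hvm : ∀ k, AEStronglyMeasurable (uncurry (v k)) (volume.restrict Q₀) := fun k =>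
    (hwgk k).locallyIntegrableOn.aestronglyMeasurable
  have hum : AEStronglyMeasurable (uncurry u) (volume.restrict Q₀) :=
    hGu.locallyIntegrableOn.aestronglyMeasurable
  -- `A`
  have hA : cknAEss r z u ≤ I :=
    cknAEss_le_of_tendsto_eLpNorm hr hzQ (fun j => hvm (σ j)) hum hconv34
      fun j => cknAEss_le_abScaledSum.trans (hbd (σ j))
  -- `C`
  have hC : cknC r z u ≤ I :=
    cknC_le_of_tendsto_eLpNorm hr hzQ (fun j => hvm (σ j)) hum hconv34
      fun j => cknC_le_abScaledSum.trans (hbd (σ j))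
  -- `D`
  have hqmem : ∀ k, MemLp (uncurry (q k)) (3 / 2) (volume.restrict Q₀) := fun k =>
    MemLp.mono_measure (Measure.restrict_mono (hmono (by norm_num) (by norm_num) 0) le_rfl)
      (hball k).2.2.2
  have hDeq : ∀ k, cknDOsc r z (q k) = cknDOsc r z (qf k) := by
    intro k
    refine cknDOsc_sub_fun_time_of_integrableOn hr _ ?_
    have hm : MemLp (uncurry (qf k)) (3 / 2) (volume.restrict (parabolicCylinder r z)) :=
      MemLp.mono_measure (Measure.restrict_mono (hzQ.trans (hmono (by norm_num) (by norm_num) 0))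
        le_rfl) (memLp_zoom_pressure hsw (hcpos k) hz₁ z₁.2)
    haveI : IsFiniteMeasure (volume.restrict (parabolicCylinder r z)) :=
      ⟨by rw [Measure.restrict_apply_univ]; exact (volume_parabolicCylinder_ne_top r z).lt_top⟩
    exact hm.integrable threeHalves_facts.1
  have hD : cknDOsc r z p ≤ I :=
    cknDOsc_le_of_tendsto_weakly hr hzQ (fun j => hqmem (σ j)) hp34 hweak34
      fun j => (hDeq (σ j)).le.trans (cknDOsc_le_abScaledSum.trans (hbd (σ j)))
  -- `E`
  have hE : cknE r z Gu ≤ I :=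
    cknE_le_of_tendsto_eLpNorm hr hzQ (fun j => (hwgk (σ j)).mono hleΩ) (hGu.mono hleΩ)
      (lt_of_le_of_lt (lintegral_mono_set hzQ) hGu2) hconv34
      fun j => cknE_le_abScaledSum.trans (hbd (σ j))
  exact add_le_add (add_le_add (add_le_add hA hC) hD) hE

/-- The same with Lemma 2.2 and Prop. 2.3 discharged in tree (`SuitableCompactness_holds`,
`PersistenceOfSingularities_holds`): **every non-trivial suitable weak slab solution with `𝐈 < ∞`
exhibits a Type I singularity.** [cite: AlbrittonBarker2019, Thm 1.1 and §3] -/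
theorem localTypeISingularityExists_of_suitable_nontrivial'
    {u₀ : ℝ → EuclideanSpace ℝ (Fin 3) → EuclideanSpace ℝ (Fin 3)}
    {p₀ : ℝ → EuclideanSpace ℝ (Fin 3) → ℝ}
    {G₀ : ℝ → EuclideanSpace ℝ (Fin 3) → EuclideanSpace ℝ (Fin 3) →L[ℝ] EuclideanSpace ℝ (Fin 3)}
    (hsw : IsSuitableWeakSolutionOn (slab (EuclideanSpace ℝ (Fin 3)) (Iio 0) isOpen_Iio) 1 0 u₀ p₀)
    (hwg : HasWeakSpatialGradientOn (slab (EuclideanSpace ℝ (Fin 3)) (Iio 0) isOpen_Iio) u₀ G₀)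
    (hnt : ¬ (uncurry u₀ =ᵐ[volume.restrict (Iio (0 : ℝ) ×ˢ (univ : Set (EuclideanSpace ℝ (Fin 3))))] 0))
    (hI : typeIBound (Iio (0 : ℝ) ×ˢ (univ : Set (EuclideanSpace ℝ (Fin 3)))) u₀ p₀ G₀ < ∞) :
    LocalTypeISingularityExists :=
  localTypeISingularityExists_of_suitable_nontrivial SuitableCompactness_holds
    PersistenceOfSingularities_holds hsw hwg hnt hI

end Literature.Analysis.FluidPDE
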